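/-
Origin: expansion seat `planner-pub-hodgecm-mc-axioms-1-g14-0`, handover #W75 2026-08-20T15:53:55Z md5 69fdbb0e3c30 (PKG 675eb007e520 → 69fdbb0e3c30; 398 l.; MECHANICAL (iib-R) rewrite v3.1 of the PKG file as it stands (9 token edits; rules R1x1+RX[h₂']x8)) (`HOME/mc/pub-hodgecm-mc-axioms-1-g14/revendor/kit-r55/stage55/HodgeCM/Model/ThetaAdelicSideInstance.lean`, md5 69fdbb0e3c30, 398 lines);
landed by the gen-22 packager (p-g22) in gate run 55 REPLACES the earlier landed copy of `HodgeCM/Model/ThetaAdelicSideInstance.lean` (seat copy carried the packager Origin header of an earlier run (stripped)).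
-/
/-
HodgeCM/Model/ThetaAdelicSideInstance.lean — sinst-1 lane (unit pub-hodgecm-mc-sinst-1, seat prover-pub-hodgecm-mc-sinst-1-0, 2026-08-19),
BINDER-OWNERS row 5 `S`: the TOTAL honest S family in E's binder currency

  `S : ∀ {L} {ι₁} (V : HermSpace3 L ι₁) (c : SeesawCtx L), ThetaAdelicSide V c`        (`Model.perL_picardCM_r15A`, binder `S`)

as a thin layer over period-1's S pin TERM `archSideOf` (#1099 `HodgeCM/Model/ArchSideOf.lean`).  `archSideOf V c … h₁W A` takes the sign
hypothesis `h₁W : (∀ j, 0 < (ι₁ (dW c.D j)).re) ∨ ∀ j, (ι₁ (dW c.D j)).re < 0` (the plane `⟨a₀, a₁⟩` of the see-saw datum is DEFINITE at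
`ι₁`), which holds at every good context (PerL Def 3.2 forced signs + `σ ∈ Ψ_i`: binder-1 `SignRecipe.re_pos_iff_of_goodCtx`,
`Binders/GramWRegime.lean`) but NOT for every `(V, c)`; quantified universally (`h₁W : ∀ {L ι₁} V c, …`, as in the pin family
`Gen12Pins.S` of `Binders/Gen12SeesawOfArchSide.lean`) it is a FALSE hypothesis and would make an END-STATE corollary carrying it vacuous.
This file removes it, following the plan of record (model1 (S-restr) note (i) 2026-08-19T12:54:54Z; glue-1/model1 «GoodCtx-guard
pattern», STATUS l.11736): a classical `dite` on the sign condition itself, with sanity-1's degenerate side as the never-evaluated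
fallback, whose one unguarded E-obligation — row 13 `hT`, NOT under `GoodCtx` in E — is kernel (`Sanity/ThetaAdelicSideDegenerateLF`).

§1 `dW_definite_of_re_pos_iff` / `dW_definite_of_goodCtx` / `dW_definite_of_thetaModel_goodCtx` — `h₁W` READ OFF the context: from
   `SignRecipe.GoodCtx h ι₁ c` (any sign bit `h`), hence from the guard `(C.thetaModel h d12 d34).GoodCtx ι₁ c` of the END STATE of ANY core
   (`AdelicThetaCore.thetaModel_goodCtx_iff`), in particular E's `(pinT … W S μ).GoodCtx ι₁ c` (`Gen12TorusCurrency.pinT_eq_thetaModel`, rfl).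
§2 `thetaAdelicSideOf V c hGR hGR₀ hGR₁ hGR₂ hGR₃ η hη hηc A : ThetaAdelicSide V c` — THE TOTAL TERM: `archSideOf V c … h A` if
   `h : ⟨plane definite at ι₁⟩`, else `Sanity.degThetaAdelicSide₀ V c`; NO `h₁W` binder.  Inputs = exactly the legitimately universal inputs of
   `archSideOf`: the five compatible splittings `hGR hGR₀ hGR₁ hGR₂ hGR₃` ([GelbartRogawski1991, Prop. 3.1.1 p. 455] — cited `Prop`s, true for
   all data), the W pin's twist character `η` with `hη` (trivial on rational points) and `hηc` (continuous) (unitary-1 `WmInstanceV2`), and the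
   archimedean line inputs `A k : ArchLineInput V (lineRepD … k)` (theta-3 `HodgeCM/Model/ArchLineInputOf.lean`, RUN 38+).
   `thetaAdelicSideOf_eq_archSideOf (h)` (`dif_pos`), `…_eq_degThetaAdelicSide₀ (h)` (`dif_neg`), `…_eq_archSideOf_of_goodCtx`,
   `…_eq_archSideOf_of_thetaModel_goodCtx`: under the guard the total term IS period-1's term, so every junction theorem stated at
   `archSideOf` (period-1 §S read-backs, binder-1 `Gen12Pins`/`SeesawCore.ofArchSide*`, theta-3's pin lemmas) transports by ONE rewrite;
   samples: `op_thetaAdelicSideOf`, `seesaw34_thetaAdelicSideOf`, `op34_thetaAdelicSideOf`, `thetaAdelicSideOf_ιinf_apply`.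
§3 row 13 at the total term: `isLFAction_thetaAdelicSideOf_of` / `isThetaArchContinuous_thetaAdelicSideOf_of` from ONE honest-branch input
   `hLF : ∀ k g, IsLFContinuous (lineRepD V c.D hGR hGR₀ hGR₁ hGR₂ hGR₃ η k g)` (LF-continuity of the four S-side line representations —
   theta-3's row-13 lemma at the honest term, the producer chain `Weil1964/AdelicThetaArchContinuity` + `Model/ThetaHolContinuity` being built;
   NAMED HOLE, owner theta-3) and sanity-1's `isLFAction_degThetaAdelicSide₀` on the fallback (kernel).
§4 transport of E's data binder `C : ArchKTypeData (thetaSpaceInputIn … (S V c) hV) k N` and of its companions `hpd`/`hk` along an equality of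
   sides (`castSide`, `isWeaklyPDiff_castSide_iff`, `isPMinusKilled_castSide_iff`, by `subst`) — what the END-STATE corollary needs to feed a
   `C` constructed at `archSideOf …` to E at `S := SInstance.S …`.
§5 E currency (namespace `SInstance`): the FAMILY `SInstance.S @hGR @η @hη @hηc @hGR₀ @hGR₁ @hGR₂ @hGR₃ @A : ∀ {L ι₁} V c, ThetaAdelicSide V c`
   (= binder-1's `Gen12Pins.S` WITHOUT `@h₁W`; `@`-spelling per their ELABORATION NOTE), `S_apply` (rfl), `S_eq_archSideOf_of_goodCtx`,
   `S_eq_gen12PinsS_of`-free (we do not import `Binders/*`), and E's row-13 binders in their literal quantifier shapes `SInstance.hLF_of` /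
   `SInstance.hT_of` from the family form of the §3 input (hypothesis-free `SInstance.hLF` / `SInstance.hT` in the sibling leaf
   `HodgeCM/Model/ThetaAdelicSideLF.lean`).

KERNEL ONLY: 0 records, 0 `def … : Prop`, nothing cited, MODEL-N ±0, E TYPE ±0.  RUN-37 world (imports #1099 r3/r3c); the RUN-38 variant adds
theta-3's two `Level` pin fields through #1101 r5b and needs sanity-1's RUN-38 re-cut of `degThetaAdelicSide₀` — no statement here changes.
-/
import Summits.HodgeConjecture.HodgeCM.Model.ArchSideOf_2
import Summits.HodgeConjecture.HodgeCM.Model.Sanity.ThetaAdelicSideDegenerateLF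
import Summits.HodgeConjecture.HodgeCM.Model.Binders.GramWRegime

set_option autoImplicit false

noncomputable section

open scoped Matrix SchwartzMap
open NumberField NumberField.mixedEmbedding
open Literature.NumberTheory.Automorphic Literature.NumberTheory.Weil1964
open Literature.NumberTheory.GelbartRogawski1991.UnitaryDualPair
open HodgeCM.Adelic HodgeCM.PerL34
open Literature.Geometry.ComplexHyperbolic.BallModel (U21)
open Literature.AlgebraicGeometry.HodgeTheory
open Literature.NumberTheory.Automorphic.PicardCM

namespace HodgeCM.Model

namespace ArchSideTerm

/-! ## §1 The sign hypothesis `h₁W` read off the context -/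

section Guard

variable {L : CMField} (ι₁ : L →+* ℂ) (c : SeesawCtx L)

/-- `h₁W` (the plane `⟨a₀, a₁⟩` is definite at `ι₁`) from the common-sign statement `0 < Re ι₁(a₀) ↔ 0 < Re ι₁(a₁)`
(the line discriminants are nonzero reals at every embedding: `SignRecipe.re_embedding_a_ne_zero`). -/
theorem dW_definite_of_re_pos_iff (hs : 0 < (ι₁ (c.D.a 0)).re ↔ 0 < (ι₁ (c.D.a 1)).re) :
    (∀ j, 0 < (ι₁ (dW c.D j)).re) ∨ ∀ j, (ι₁ (dW c.D j)).re < 0 := by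
  by_cases h0 : 0 < (ι₁ (c.D.a 0)).re
  · refine Or.inl fun j => ?_
    fin_cases j
    · exact h0
    · exact hs.mp h0
  · have h0' : (ι₁ (c.D.a 0)).re < 0 := lt_of_le_of_ne (not_lt.mp h0) (SignRecipe.re_embedding_a_ne_zero c ι₁ 0)
    have h1' : (ι₁ (c.D.a 1)).re < 0 :=
      lt_of_le_of_ne (not_lt.mp fun h1 => h0 (hs.mpr h1)) (SignRecipe.re_embedding_a_ne_zero c ι₁ 1)
    refine Or.inr fun j => ?_
    fin_cases j
    · exact h0'
    · exact h1'

/-- **`h₁W` at a good context** (PerL's model-free recipe guard, any sign bit `h`): binder-1's (J-hW)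
`SignRecipe.re_pos_iff_of_goodCtx` (forced signs + `σ ∈ Ψ_i` ⇒ all four lines have the same sign at `ι₁`). -/
theorem dW_definite_of_goodCtx (h : Bool) (hc : SignRecipe.GoodCtx h ι₁ c) :
    (∀ j, 0 < (ι₁ (dW c.D j)).re) ∨ ∀ j, (ι₁ (dW c.D j)).re < 0 :=
  dW_definite_of_re_pos_iff ι₁ c (SignRecipe.re_pos_iff_of_goodCtx hc 0 1)

/-- **`h₁W` at a good context of the END STATE of ANY core** — in particular at E's guard
`(pinT hHD hI h₁ h₂ h₃ h hA W S μ).GoodCtx ι₁ c` (`pinT_eq_thetaModel`, `rfl`), whatever `W`, `S`, `μ`. -/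
theorem dW_definite_of_thetaModel_goodCtx {U : Universe} {hP : PrintFact_unitaryCompact} (C : U.AdelicThetaCore hP) (h : Bool)
    (d12 d34 : ∀ {L : CMField}, SeesawCtx L → Universe.SideData L) (hc : (C.thetaModel h d12 d34).GoodCtx ι₁ c) :
    (∀ j, 0 < (ι₁ (dW c.D j)).re) ∨ ∀ j, (ι₁ (dW c.D j)).re < 0 :=
  dW_definite_of_goodCtx ι₁ c h ((C.thetaModel_goodCtx_iff h d12 d34 ι₁ c).mp hc)

end Guard

/-! ## §2 The total S term -/

section Total

variable {L : CMField} {ι₁ : L →+* ℂ} (V : HermSpace3 L ι₁) (c : SeesawCtx L)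
  (hGR : (cmSplittingDatum (L : Type) finProdFinEquiv (frameD V) (frameD_real V) (frameD_ne V) (dW c.D) (dW_real c.D)
    (dW_ne c.D)).CompatibleSplitting)
  (hGR₀ : (cmSplittingDatum (L : Type) (e₁) (frameD V) (frameD_real V) (frameD_ne V) (lineVec (L : Type) (dW c.D 0))
    (fun _ => dW_real c.D 0) (fun _ => dW_ne c.D 0)).CompatibleSplitting)
  (hGR₁ : (cmSplittingDatum (L : Type) (e₁) (frameD V) (frameD_real V) (frameD_ne V) (lineVec (L : Type) (dW c.D 1))
    (fun _ => dW_real c.D 1) (fun _ => dW_ne c.D 1)).CompatibleSplitting)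
  (hGR₂ : (cmSplittingDatum (L : Type) (e₁) (frameD V) (frameD_real V) (frameD_ne V) (lineVec (L : Type) (dW' c.D 0))
    (fun _ => dW'_real c.D 0) (fun _ => dW'_ne c.D 0)).CompatibleSplitting)
  (hGR₃ : (cmSplittingDatum (L : Type) (e₁) (frameD V) (frameD_real V) (frameD_ne V) (lineVec (L : Type) (dW' c.D 1))
    (fun _ => dW'_real c.D 1) (fun _ => dW'_ne c.D 1)).CompatibleSplitting)
  (η : CMAdelic (L : Type) (frameD V) × CMAdelic (L : Type) (dW c.D) →* ℂˣ)
  (hη : ∀ γU ∈ CMRat (L : Type) (frameD V), ∀ γ ∈ CMRat (L : Type) (dW c.D), η (γU, γ) = 1)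
  (hηc : Continuous fun p => ((η p : ℂˣ) : ℂ))
  (A : ∀ k : Fin 4, ArchLineInput V (lineRepD V c.D hGR hGR₀ hGR₁ hGR₂ hGR₃ η k))

open scoped Classical in
/-- **THE TOTAL S TERM** `thetaAdelicSideOf V c … : ThetaAdelicSide V c`, defined at EVERY context with no sign hypothesis:
period-1's honest term `archSideOf V c … h A` when `h :` the plane `⟨a₀, a₁⟩` is definite at `ι₁` (always the case at a good
context, §1), sanity-1's degenerate side `degThetaAdelicSide₀ V c` otherwise (never evaluated by E: rows 12, 14–19 are
`GoodCtx`-guarded, row 13 holds on both branches, §3). -/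
def thetaAdelicSideOf : ThetaAdelicSide V c :=
  if h : (∀ j, 0 < (ι₁ (dW c.D j)).re) ∨ ∀ j, (ι₁ (dW c.D j)).re < 0 then
    archSideOf V c hGR hGR₀ hGR₁ hGR₂ hGR₃ η hη hηc h A
  else Sanity.degThetaAdelicSide₀ V c

/-- Under the sign condition the total term IS period-1's term (`dif_pos`). -/
theorem thetaAdelicSideOf_eq_archSideOf (h : (∀ j, 0 < (ι₁ (dW c.D j)).re) ∨ ∀ j, (ι₁ (dW c.D j)).re < 0) :
    thetaAdelicSideOf V c hGR hGR₀ hGR₁ hGR₂ hGR₃ η hη hηc A = archSideOf V c hGR hGR₀ hGR₁ hGR₂ hGR₃ η hη hηc h A := by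
  classical
  exact dif_pos h

/-- Off the sign condition the total term is the degenerate side (`dif_neg`). -/
theorem thetaAdelicSideOf_eq_degThetaAdelicSide₀ (h : ¬ ((∀ j, 0 < (ι₁ (dW c.D j)).re) ∨ ∀ j, (ι₁ (dW c.D j)).re < 0)) :
    thetaAdelicSideOf V c hGR hGR₀ hGR₁ hGR₂ hGR₃ η hη hηc A = Sanity.degThetaAdelicSide₀ V c := by
  classical
  exact dif_neg h

/-- **At a good context (recipe guard) the total term is period-1's term** at the READ-OFF sign hypothesis. -/
theorem thetaAdelicSideOf_eq_archSideOf_of_goodCtx (h : Bool) (hc : SignRecipe.GoodCtx h ι₁ c) :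
    thetaAdelicSideOf V c hGR hGR₀ hGR₁ hGR₂ hGR₃ η hη hηc A =
      archSideOf V c hGR hGR₀ hGR₁ hGR₂ hGR₃ η hη hηc (dW_definite_of_goodCtx ι₁ c h hc) A :=
  thetaAdelicSideOf_eq_archSideOf V c hGR hGR₀ hGR₁ hGR₂ hGR₃ η hη hηc A _

/-- … and at a good context of the END STATE of any core (E's guard). -/
theorem thetaAdelicSideOf_eq_archSideOf_of_thetaModel_goodCtx {U : Universe} {hP : PrintFact_unitaryCompact}
    (C : U.AdelicThetaCore hP) (h : Bool) (d12 d34 : ∀ {L : CMField}, SeesawCtx L → Universe.SideData L)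
    (hc : (C.thetaModel h d12 d34).GoodCtx ι₁ c) :
    thetaAdelicSideOf V c hGR hGR₀ hGR₁ hGR₂ hGR₃ η hη hηc A =
      archSideOf V c hGR hGR₀ hGR₁ hGR₂ hGR₃ η hη hηc (dW_definite_of_thetaModel_goodCtx ι₁ c C h d12 d34 hc) A :=
  thetaAdelicSideOf_eq_archSideOf V c hGR hGR₀ hGR₁ hGR₂ hGR₃ η hη hηc A _

/-! ### junction read-backs at the total term, under the sign condition (ONE rewrite each) -/

/-- the arithmetic subgroup of every pair datum is `G_U(L⁺)` on BOTH branches (the record's own field `hΓU`). -/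
theorem thetaAdelicSideOf_P_ΓU (k : Fin 4) :
    ((thetaAdelicSideOf V c hGR hGR₀ hGR₁ hGR₂ hGR₃ η hη hηc A).P k).ΓU = (V.latticeModel printFact_unitaryCompact_holds).Γ :=
  (thetaAdelicSideOf V c hGR hGR₀ hGR₁ hGR₂ hGR₃ η hη hηc A).hΓU k

/-- `(P k).ω = lineRepOf … k` under the sign condition (period-1's `archSideOf_P_ω`, (J5)). -/
theorem thetaAdelicSideOf_P_ω (h : (∀ j, 0 < (ι₁ (dW c.D j)).re) ∨ ∀ j, (ι₁ (dW c.D j)).re < 0) (k : Fin 4) :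
    ((thetaAdelicSideOf V c hGR hGR₀ hGR₁ hGR₂ hGR₃ η hη hηc A).P k).ω =
      lineRepOf V c.D hGR hGR₀ hGR₁ hGR₂ hGR₃ (eta₀ V c.D η) (eta₁ V c.D η) (eta₂ V c.D η) (eta₃ V c.D η) k := by
  rw [thetaAdelicSideOf_eq_archSideOf V c hGR hGR₀ hGR₁ hGR₂ hGR₃ η hη hηc A h]; rfl

/-- `ιinf = archInfOf V` under the sign condition (#1097). -/
theorem thetaAdelicSideOf_ιinf (h : (∀ j, 0 < (ι₁ (dW c.D j)).re) ∨ ∀ j, (ι₁ (dW c.D j)).re < 0) :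
    (thetaAdelicSideOf V c hGR hGR₀ hGR₁ hGR₂ hGR₃ η hη hηc A).ιinf = archInfOf V := by
  rw [thetaAdelicSideOf_eq_archSideOf V c hGR hGR₀ hGR₁ hGR₂ hGR₃ η hη hηc A h]; rfl

/-- `Gfin = archFinOf V` under the sign condition (#1097). -/
theorem thetaAdelicSideOf_Gfin (h : (∀ j, 0 < (ι₁ (dW c.D j)).re) ∨ ∀ j, (ι₁ (dW c.D j)).re < 0) :
    (thetaAdelicSideOf V c hGR hGR₀ hGR₁ hGR₂ hGR₃ η hη hηc A).Gfin = archFinOf V := by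
  rw [thetaAdelicSideOf_eq_archSideOf V c hGR hGR₀ hGR₁ hGR₂ hGR₃ η hη hηc A h]; rfl

/-- the archimedean test data are theta-3's `A k` under the sign condition. -/
theorem thetaAdelicSideOf_P_Φinf (h : (∀ j, 0 < (ι₁ (dW c.D j)).re) ∨ ∀ j, (ι₁ (dW c.D j)).re < 0) (k : Fin 4) :
    ((thetaAdelicSideOf V c hGR hGR₀ hGR₁ hGR₂ hGR₃ η hη hηc A).P k).Φinf = (A k).Φinf := by
  rw [thetaAdelicSideOf_eq_archSideOf V c hGR hGR₀ hGR₁ hGR₂ hGR₃ η hη hηc A h]; rfl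

/-- (Ported verbatim from the HodgeCMPerL package; no docstring in the source.) -/
theorem thetaAdelicSideOf_P_x₀ (h : (∀ j, 0 < (ι₁ (dW c.D j)).re) ∨ ∀ j, (ι₁ (dW c.D j)).re < 0) (k : Fin 4) :
    ((thetaAdelicSideOf V c hGR hGR₀ hGR₁ hGR₂ hGR₃ η hη hηc A).P k).x₀ = (A k).x₀ := by
  rw [thetaAdelicSideOf_eq_archSideOf V c hGR hGR₀ hGR₁ hGR₂ hGR₃ η hη hηc A h]; rfl

/-- (Ported verbatim from the HodgeCMPerL package; no docstring in the source.) -/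
theorem thetaAdelicSideOf_P_w (h : (∀ j, 0 < (ι₁ (dW c.D j)).re) ∨ ∀ j, (ι₁ (dW c.D j)).re < 0) (k : Fin 4) :
    ((thetaAdelicSideOf V c hGR hGR₀ hGR₁ hGR₂ hGR₃ η hη hηc A).P k).w = (A k).w := by
  rw [thetaAdelicSideOf_eq_archSideOf V c hGR hGR₀ hGR₁ hGR₂ hGR₃ η hη hηc A h]; rfl

/-- D-1′ `hι` at the total term (period-1 `archSideOf_ιinf_apply`): `ιinf u = regimeEquiv L V.Hm hV (archSectionU21CM … u)`. -/
theorem thetaAdelicSideOf_ιinf_apply (h : (∀ j, 0 < (ι₁ (dW c.D j)).re) ∨ ∀ j, (ι₁ (dW c.D j)).re < 0)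
    (hV : IsAnisotropic L V.Hm) (u : U21) :
    (thetaAdelicSideOf V c hGR hGR₀ hGR₁ hGR₂ hGR₃ η hη hηc A).ιinf u =
      Adelic.regimeEquiv L V.Hm hV
        (UnitaryGroup.archSectionU21CM (L : Type) ι₁ V.Hm V.sylvesterFrame (sylvesterFrame_J V) u) := by
  rw [thetaAdelicSideOf_eq_archSideOf V c hGR hGR₀ hGR₁ hGR₂ hGR₃ η hη hηc A h]
  exact archSideOf_ιinf_apply V c hGR hGR₀ hGR₁ hGR₂ hGR₃ η hη hηc h A hV u

/-- (L3b) at the total term: `regimeEquiv … (e.symm (1, k_f)) ∈ Gfin` under the sign condition. -/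
theorem regimeEquiv_prodSymm_one_mem_thetaAdelicSideOf_Gfin
    (h : (∀ j, 0 < (ι₁ (dW c.D j)).re) ∨ ∀ j, (ι₁ (dW c.D j)).re < 0) (hV : IsAnisotropic L V.Hm)
    (kf : ↥(UnitaryGroup.finAdelic (↥(maximalRealSubfield L)) (L : Type) (IsCMField.complexConj L) 3 V.Hm)) :
    (Adelic.regimeEquiv L V.Hm hV ((UnitaryGroup.cmAdelicProdEquiv (L : Type) 3 V.Hm).symm (1, kf)) :
        (V.latticeModel printFact_unitaryCompact_holds).G) ∈
      (thetaAdelicSideOf V c hGR hGR₀ hGR₁ hGR₂ hGR₃ η hη hηc A).Gfin := by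
  rw [thetaAdelicSideOf_Gfin V c hGR hGR₀ hGR₁ hGR₂ hGR₃ η hη hηc A h]
  exact regimeEquiv_prodSymm_one_mem_archFinOf V hV kf

/-- binder-1's **`op`** (RECORD 2′ `SeesawCore.ofOp`) at the total term under the sign condition: period-1's `op_archSideOf`. -/
theorem op_thetaAdelicSideOf (h : (∀ j, 0 < (ι₁ (dW c.D j)).re) ∨ ∀ j, (ι₁ (dW c.D j)).re < 0)
    (g : ↥(regimeSubgroup L V.Hm)) (t : SeesawTorus (↥(maximalRealSubfield L)) L)
    (φ₁ φ₂ : piSchwartzBruhat (↥(maximalRealSubfield L)) (Fin 3)) :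
    cmPairRepTwist (L : Type) finProdFinEquiv (frameD V) (frameD_real V) (frameD_ne V) (dW c.D) (dW_real c.D) (dW_ne c.D) hGR η
        ((cmFrameEquiv (L : Type) (frameG V) V.Hm (frameD V) (frame_congr V)) (g : ↥(HodgeCM.Adelic.adelicUnitaryGroup (L : Type) V.Hm)),
          cmAdelicEquiv (L : Type) 2 (Matrix.diagonal (dW c.D)) (c.D.jT₁₂ t)) (tau12 V c.D φ₁ φ₂) =
      tau12 V c.D (((thetaAdelicSideOf V c hGR hGR₀ hGR₁ hGR₂ hGR₃ η hη hηc A).P 0).ω (g, SeesawTorus.fst _ L t) φ₁)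
        (((thetaAdelicSideOf V c hGR hGR₀ hGR₁ hGR₂ hGR₃ η hη hηc A).P 1).ω (g, SeesawTorus.snd _ L t) φ₂) := by
  rw [thetaAdelicSideOf_eq_archSideOf V c hGR hGR₀ hGR₁ hGR₂ hGR₃ η hη hηc A h]
  exact op_archSideOf V c hGR hGR₀ hGR₁ hGR₂ hGR₃ η hη hηc h A g t φ₁ φ₂

/-- binder-1's **`seesaw`** (`SeesawHyp34`) at the total term under the sign condition: period-1's `seesaw34_archSideOf`. -/
theorem seesaw34_thetaAdelicSideOf (h : (∀ j, 0 < (ι₁ (dW c.D j)).re) ∨ ∀ j, (ι₁ (dW c.D j)).re < 0)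
    (g : ↥(regimeSubgroup L V.Hm)) (t : SeesawTorus (↥(maximalRealSubfield L)) L)
    (φ₂ φ₃ : piSchwartzBruhat (↥(maximalRealSubfield L)) (Fin 3)) :
    thetaDistLM (↥(maximalRealSubfield L)) (Fin 6)
        (cmPairRepTwist (L : Type) finProdFinEquiv (frameD V) (frameD_real V) (frameD_ne V) (dW c.D) (dW_real c.D) (dW_ne c.D) hGR η
          ((cmFrameEquiv (L : Type) (frameG V) V.Hm (frameD V) (frame_congr V)) (g : ↥(HodgeCM.Adelic.adelicUnitaryGroup (L : Type) V.Hm)),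
            cmAdelicEquiv (L : Type) 2 (Matrix.diagonal (dW c.D)) (c.D.jT₃₄ t)) (tau34 V c.D φ₂ φ₃)) =
      thetaDistLM (↥(maximalRealSubfield L)) (Fin 3)
          (((thetaAdelicSideOf V c hGR hGR₀ hGR₁ hGR₂ hGR₃ η hη hηc A).P 2).ω (g, SeesawTorus.fst _ L t) φ₂) *
        thetaDistLM (↥(maximalRealSubfield L)) (Fin 3)
          (((thetaAdelicSideOf V c hGR hGR₀ hGR₁ hGR₂ hGR₃ η hη hηc A).P 3).ω (g, SeesawTorus.snd _ L t) φ₃) := by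
  rw [thetaAdelicSideOf_eq_archSideOf V c hGR hGR₀ hGR₁ hGR₂ hGR₃ η hη hηc A h]
  exact seesaw34_archSideOf V c hGR hGR₀ hGR₁ hGR₂ hGR₃ η hη hηc h A g t φ₂ φ₃

/-- the operator-level (34) identity at the total term under the sign condition: period-1's `op34_archSideOf`. -/
theorem op34_thetaAdelicSideOf (h : (∀ j, 0 < (ι₁ (dW c.D j)).re) ∨ ∀ j, (ι₁ (dW c.D j)).re < 0)
    (g : ↥(regimeSubgroup L V.Hm)) (t : SeesawTorus (↥(maximalRealSubfield L)) L)
    (φ₂ φ₃ : piSchwartzBruhat (↥(maximalRealSubfield L)) (Fin 3)) :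
    cmPairRepTwist (L : Type) finProdFinEquiv (frameD V) (frameD_real V) (frameD_ne V) (dW c.D) (dW_real c.D) (dW_ne c.D) hGR η
        ((cmFrameEquiv (L : Type) (frameG V) V.Hm (frameD V) (frame_congr V)) (g : ↥(HodgeCM.Adelic.adelicUnitaryGroup (L : Type) V.Hm)),
          cmAdelicEquiv (L : Type) 2 (Matrix.diagonal (dW c.D)) (c.D.jT₃₄ t)) (tau34 V c.D φ₂ φ₃) =
      tau34 V c.D (((thetaAdelicSideOf V c hGR hGR₀ hGR₁ hGR₂ hGR₃ η hη hηc A).P 2).ω (g, SeesawTorus.fst _ L t) φ₂)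
        (((thetaAdelicSideOf V c hGR hGR₀ hGR₁ hGR₂ hGR₃ η hη hηc A).P 3).ω (g, SeesawTorus.snd _ L t) φ₃) := by
  rw [thetaAdelicSideOf_eq_archSideOf V c hGR hGR₀ hGR₁ hGR₂ hGR₃ η hη hηc A h]
  exact op34_archSideOf V c hGR hGR₀ hGR₁ hGR₂ hGR₃ η hη hηc h A g t φ₂ φ₃

/-! ## §3 Row 13 (`hT`) at the total term -/

/-- **LF-continuity of the pair actions of the total term** on BOTH branches, from LF-continuity of the four honest line
representations `lineRepD … k` (the honest-branch input, theta-3's row-13 lemma at the term) and sanity-1's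
`isLFAction_degThetaAdelicSide₀` (fallback, kernel: `ω = 1`). -/
theorem isLFAction_thetaAdelicSideOf_of
    (hLF : ∀ (k : Fin 4) (g : ↥(regimeSubgroup L V.Hm) × ↥(NumberField.relNormOneIdeles (↥(maximalRealSubfield L)) L)),
      IsLFContinuous (lineRepD V c.D hGR hGR₀ hGR₁ hGR₂ hGR₃ η k g))
    (k : Fin 4) : ((thetaAdelicSideOf V c hGR hGR₀ hGR₁ hGR₂ hGR₃ η hη hηc A).P k).IsLFAction := by
  by_cases h : (∀ j, 0 < (ι₁ (dW c.D j)).re) ∨ ∀ j, (ι₁ (dW c.D j)).re < 0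
  · rw [thetaAdelicSideOf_eq_archSideOf V c hGR hGR₀ hGR₁ hGR₂ hGR₃ η hη hηc A h]
    exact fun g => hLF k g
  · rw [thetaAdelicSideOf_eq_degThetaAdelicSide₀ V c hGR hGR₀ hGR₁ hGR₂ hGR₃ η hη hηc A h]
    exact Sanity.isLFAction_degThetaAdelicSide₀ V c k

/-- **Row 13 `hT` at the total term**: (H1) from LF-continuity (theta-3 `WeilPairData.isThetaArchContinuous_of_isLFContinuous`,
[Weil1964, Chap. III n° 41 Thm 6] via the tree's `AdelicThetaArchContinuity`), both branches. -/
theorem isThetaArchContinuous_thetaAdelicSideOf_of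
    (hLF : ∀ (k : Fin 4) (g : ↥(regimeSubgroup L V.Hm) × ↥(NumberField.relNormOneIdeles (↥(maximalRealSubfield L)) L)),
      IsLFContinuous (lineRepD V c.D hGR hGR₀ hGR₁ hGR₂ hGR₃ η k g))
    (k : Fin 4) (N : ℕ) : ((thetaAdelicSideOf V c hGR hGR₀ hGR₁ hGR₂ hGR₃ η hη hηc A).P k).IsThetaArchContinuous N :=
  ((thetaAdelicSideOf V c hGR hGR₀ hGR₁ hGR₂ hGR₃ η hη hηc A).P k).isThetaArchContinuous_of_isLFContinuous
    (isLFAction_thetaAdelicSideOf_of V c hGR hGR₀ hGR₁ hGR₂ hGR₃ η hη hηc A hLF k) N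

end Total

end ArchSideTerm

/-! ## §4 Transport of E's data binder `C` (and `hpd`/`hk`) along an equality of adelic sides -/

section Transport

variable (hHD : exists_isReal_hodgeModel) (hI : hodgePQ_independent_of_hodgeModel)
  (h₁ : BallQuotientUniformised)  (h₃ : CMAbelianVarietyRealised)
variable {L : CMField} {ι₁ : L →+* ℂ} {V : HermSpace3 L ι₁} {c : SeesawCtx L} {hV : IsAnisotropic L V.Hm} {k : Fin 4} {N : ℕ}

/-- **E's `C`-datum transported along an equality of sides** `e : S₁ = S₂` (for the END-STATE corollary: a `C` constructed at
period-1's `archSideOf …` feeds E at `S := SInstance.S …` through `e := (thetaAdelicSideOf_eq_archSideOf …).symm`). -/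
def ArchKTypeData.castSide {S₁ S₂ : ThetaAdelicSide V c} (e : S₁ = S₂)
    (C : ArchKTypeData (thetaSpaceInputIn hHD hI h₁ h₃ S₁ hV) k N) :
    ArchKTypeData (thetaSpaceInputIn hHD hI h₁ h₃ S₂ hV) k N :=
  e ▸ C

/-- (Ported verbatim from the HodgeCMPerL package; no docstring in the source.) -/
@[simp] theorem ArchKTypeData.castSide_rfl {S₁ : ThetaAdelicSide V c} (C : ArchKTypeData (thetaSpaceInputIn hHD hI h₁ h₃ S₁ hV) k N) :
    ArchKTypeData.castSide hHD hI h₁ h₃ rfl C = C := rfl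

/-- (AN) `hpd` is invariant under transport of `C` along `S₁ = S₂` (the chart `BallForms.expP` lands in `U(2,1) = X.G₁` on both sides). -/
theorem ArchKTypeData.isWeaklyPDiff_castSide_iff {S₁ S₂ : ThetaAdelicSide V c} (e : S₁ = S₂)
    (C : ArchKTypeData (thetaSpaceInputIn hHD hI h₁ h₃ S₁ hV) k N) :
    (ArchKTypeData.castSide hHD hI h₁ h₃ e C).IsWeaklyPDiff Literature.AlgebraicGeometry.ShimuraVarieties.BallForms.expP ↔
      C.IsWeaklyPDiff Literature.AlgebraicGeometry.ShimuraVarieties.BallForms.expP := by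
  subst e; rfl

/-- (REP) `hk` is invariant under transport of `C` along `S₁ = S₂`. -/
theorem ArchKTypeData.isPMinusKilled_castSide_iff {S₁ S₂ : ThetaAdelicSide V c} (e : S₁ = S₂)
    (C : ArchKTypeData (thetaSpaceInputIn hHD hI h₁ h₃ S₁ hV) k N) :
    (ArchKTypeData.castSide hHD hI h₁ h₃ e C).IsPMinusKilled Literature.AlgebraicGeometry.ShimuraVarieties.BallForms.expP ↔
      C.IsPMinusKilled Literature.AlgebraicGeometry.ShimuraVarieties.BallForms.expP := by
  subst e; rfl

end Transport

/-! ## §5 E currency: the total S FAMILY and its row-13 binders in E's literal shapes -/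

namespace SInstance

open HodgeCM.Model.ArchSideTerm

variable
  (hGR : ∀ {L : CMField} {ι₁ : L →+* ℂ} (V : HermSpace3 L ι₁) (c : SeesawCtx L),
    (cmSplittingDatum (L : Type) finProdFinEquiv (frameD V) (frameD_real V) (frameD_ne V) (dW c.D) (dW_real c.D)
      (dW_ne c.D)).CompatibleSplitting)
  (η : ∀ {L : CMField} {ι₁ : L →+* ℂ} (V : HermSpace3 L ι₁) (c : SeesawCtx L),
    CMAdelic (L : Type) (frameD V) × CMAdelic (L : Type) (dW c.D) →* ℂˣ)
  (hη : ∀ {L : CMField} {ι₁ : L →+* ℂ} (V : HermSpace3 L ι₁) (c : SeesawCtx L),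
    ∀ γU ∈ CMRat (L : Type) (frameD V), ∀ γ ∈ CMRat (L : Type) (dW c.D), η V c (γU, γ) = 1)
  (hηc : ∀ {L : CMField} {ι₁ : L →+* ℂ} (V : HermSpace3 L ι₁) (c : SeesawCtx L), Continuous fun p => ((η V c p : ℂˣ) : ℂ))
  (hGR₀ : ∀ {L : CMField} {ι₁ : L →+* ℂ} (V : HermSpace3 L ι₁) (c : SeesawCtx L),
    (cmSplittingDatum (L : Type) (e₁) (frameD V) (frameD_real V) (frameD_ne V) (lineVec (L : Type) (dW c.D 0))
      (fun _ => dW_real c.D 0) (fun _ => dW_ne c.D 0)).CompatibleSplitting)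
  (hGR₁ : ∀ {L : CMField} {ι₁ : L →+* ℂ} (V : HermSpace3 L ι₁) (c : SeesawCtx L),
    (cmSplittingDatum (L : Type) (e₁) (frameD V) (frameD_real V) (frameD_ne V) (lineVec (L : Type) (dW c.D 1))
      (fun _ => dW_real c.D 1) (fun _ => dW_ne c.D 1)).CompatibleSplitting)
  (hGR₂ : ∀ {L : CMField} {ι₁ : L →+* ℂ} (V : HermSpace3 L ι₁) (c : SeesawCtx L),
    (cmSplittingDatum (L : Type) (e₁) (frameD V) (frameD_real V) (frameD_ne V) (lineVec (L : Type) (dW' c.D 0))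
      (fun _ => dW'_real c.D 0) (fun _ => dW'_ne c.D 0)).CompatibleSplitting)
  (hGR₃ : ∀ {L : CMField} {ι₁ : L →+* ℂ} (V : HermSpace3 L ι₁) (c : SeesawCtx L),
    (cmSplittingDatum (L : Type) (e₁) (frameD V) (frameD_real V) (frameD_ne V) (lineVec (L : Type) (dW' c.D 1))
      (fun _ => dW'_real c.D 1) (fun _ => dW'_ne c.D 1)).CompatibleSplitting)
  (A : ∀ {L : CMField} {ι₁ : L →+* ℂ} (V : HermSpace3 L ι₁) (c : SeesawCtx L) (k : Fin 4),
    ArchLineInput V (lineRepD V c.D (hGR V c) (hGR₀ V c) (hGR₁ V c) (hGR₂ V c) (hGR₃ V c) (η V c) k))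

/-- **THE TOTAL HONEST S FAMILY** — E's binder `S : ∀ {L ι₁} V c, ThetaAdelicSide V c` (binder-1's `Gen12Pins.S` without the
sign family `@h₁W`).  Reducible, `@`-spelling for its family arguments (ELABORATION NOTE of `Binders/Gen12SeesawOfArchSide`). -/
abbrev S : ∀ {L : CMField} {ι₁ : L →+* ℂ} (V : HermSpace3 L ι₁) (c : SeesawCtx L), ThetaAdelicSide V c :=
  fun V c => thetaAdelicSideOf V c (hGR V c) (hGR₀ V c) (hGR₁ V c) (hGR₂ V c) (hGR₃ V c) (η V c) (hη V c) (hηc V c) (A V c)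

variable {L : CMField} {ι₁ : L →+* ℂ} (V : HermSpace3 L ι₁) (c : SeesawCtx L)

/-- read-back (definitional). -/
theorem S_apply : S @hGR @η @hη @hηc @hGR₀ @hGR₁ @hGR₂ @hGR₃ @A V c =
    thetaAdelicSideOf V c (hGR V c) (hGR₀ V c) (hGR₁ V c) (hGR₂ V c) (hGR₃ V c) (η V c) (hη V c) (hηc V c) (A V c) := rfl

/-- **At a good context the family IS period-1's term** (recipe guard, any sign bit). -/
theorem S_eq_archSideOf_of_goodCtx (h : Bool) (hc : SignRecipe.GoodCtx h ι₁ c) :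
    S @hGR @η @hη @hηc @hGR₀ @hGR₁ @hGR₂ @hGR₃ @A V c =
      archSideOf V c (hGR V c) (hGR₀ V c) (hGR₁ V c) (hGR₂ V c) (hGR₃ V c) (η V c) (hη V c) (hηc V c)
        (dW_definite_of_goodCtx ι₁ c h hc) (A V c) :=
  thetaAdelicSideOf_eq_archSideOf_of_goodCtx V c _ _ _ _ _ _ _ _ _ h hc

/-- … and under the guard of the END STATE of any core (E's `(pinT … W S μ).GoodCtx ι₁ c` by `pinT_eq_thetaModel`). -/
theorem S_eq_archSideOf_of_thetaModel_goodCtx {U : Universe} {hP : PrintFact_unitaryCompact} (C : U.AdelicThetaCore hP) (h : Bool)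
    (d12 d34 : ∀ {L : CMField}, SeesawCtx L → Universe.SideData L) (hc : (C.thetaModel h d12 d34).GoodCtx ι₁ c) :
    S @hGR @η @hη @hηc @hGR₀ @hGR₁ @hGR₂ @hGR₃ @A V c =
      archSideOf V c (hGR V c) (hGR₀ V c) (hGR₁ V c) (hGR₂ V c) (hGR₃ V c) (η V c) (hη V c) (hηc V c)
        (dW_definite_of_thetaModel_goodCtx ι₁ c C h d12 d34 hc) (A V c) :=
  thetaAdelicSideOf_eq_archSideOf_of_thetaModel_goodCtx V c _ _ _ _ _ _ _ _ _ C h d12 d34 hc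

/-- **E's binder `hLF` (R17A / `ThetaHolContinuity` END STATE) at the family**, literal quantifier shape, from LF-continuity of the honest
line representations (theta-3, row 13) — the fallback branch is kernel. -/
theorem hLF_of
    (hLF : ∀ {L : CMField} {ι₁ : L →+* ℂ} (V : HermSpace3 L ι₁) (c : SeesawCtx L) (k : Fin 4)
      (g : ↥(regimeSubgroup L V.Hm) × ↥(NumberField.relNormOneIdeles (↥(maximalRealSubfield L)) L)),
      IsLFContinuous (lineRepD V c.D (hGR V c) (hGR₀ V c) (hGR₁ V c) (hGR₂ V c) (hGR₃ V c) (η V c) k g)) :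
    ∀ {L : CMField} {ι₁ : L →+* ℂ} (V : HermSpace3 L ι₁) (c : SeesawCtx L) (k : Fin 4),
      ((S @hGR @η @hη @hηc @hGR₀ @hGR₁ @hGR₂ @hGR₃ @A V c).P k).IsLFAction :=
  fun V c k => isLFAction_thetaAdelicSideOf_of V c _ _ _ _ _ _ _ _ _ (hLF V c) k

/-- **E's row-13 binder `hT` (R15A) at the family**, literal quantifier shape. -/
theorem hT_of
    (hLF : ∀ {L : CMField} {ι₁ : L →+* ℂ} (V : HermSpace3 L ι₁) (c : SeesawCtx L) (k : Fin 4)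
      (g : ↥(regimeSubgroup L V.Hm) × ↥(NumberField.relNormOneIdeles (↥(maximalRealSubfield L)) L)),
      IsLFContinuous (lineRepD V c.D (hGR V c) (hGR₀ V c) (hGR₁ V c) (hGR₂ V c) (hGR₃ V c) (η V c) k g)) :
    ∀ {L : CMField} {ι₁ : L →+* ℂ} (V : HermSpace3 L ι₁) (c : SeesawCtx L) (k : Fin 4) (N : ℕ),
      ((S @hGR @η @hη @hηc @hGR₀ @hGR₁ @hGR₂ @hGR₃ @A V c).P k).IsThetaArchContinuous N :=
  fun V c k N => isThetaArchContinuous_thetaAdelicSideOf_of V c _ _ _ _ _ _ _ _ _ (hLF V c) k N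

end SInstance

end HodgeCM.Model

end
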